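/-
Copyright (c) 2026 the pub-hodgecm-mathlib formalisation cell (harness21).  Prover seat hodgecm-mathlib-K2E4-p11 (g5), Track B ∕ K2-LIT, h413 =
`stmt-HodgeConjecture-24833`, line `K2_E1_TraceFormulaBeta`, campaign «EIS-RANK-ONE» ∕ R8-LADDER-2, «MS-2» — the topological brick behind the `_on` edition ★ p859569:
an open convex set minus a countable set is (path-)connected; `D⁺ ∖ P` for the co-discrete pole set `P`.
-/
import Mathlib.Analysis.Normed.Module.Connected
import Mathlib.Analysis.Complex.Convex
import Mathlib.Analysis.Complex.Basic
import Mathlib.LinearAlgebra.Complex.FiniteDimensional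
import Literature.Topology.Euclidean.PlanarStaircase                 -- ★ `one_lt_rank_real_complex`
import Mathlib.Topology.DiscreteSubset
import Mathlib.Topology.Compactness.Lindelof
import HarnessLib

/-!
# h413 ∕ Track B «K2-LIT», «MS-2» — `K2E1ConvexDiffCountableConnected`: AN OPEN CONVEX SET MINUS A COUNTABLE SET IS PATH-CONNECTED (real normed spaces of dimension `> 1`);
# the domain `D⁺ ∖ P` of the `_on` edition ★ `poleControl_continued_cm_two_of_pairing_on` for a closed co-discrete pole set `P ⊆ {Re ≤ 1}`

Cell `pub/hodgecm-mathlib`, crux H413 = `stmt-HodgeConjecture-24833`, route `HCCMUnconditional`; dealer K2E1-plan (g6) (the brick named in this seat's 11:0xZ `_on` line).  THEOREMS ONLY;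
lane `--kind proof --supports stmt-HodgeConjecture-24833 --as helper` (count-neutral; closes no socket).
THE MATHEMATICS [folklore; MoeglinWaldspurger1995, IV.3.12 (a) for the use].  Mathlib's `Set.Countable.isPathConnected_compl_of_one_lt_rank` joins two points `a = c − x`, `b = c + x` of the
complement of a countable `s` through a third point `c + t•y` (`y` independent of `x`): the segments `[a, c + t•y]` for distinct `t` meet only at `a`, so only countably many of them meet
`s`, and likewise for `b`.  Inside an OPEN CONVEX `C` the same works with `t` restricted to a small interval (so that `c + t•y ∈ C`; the segments then lie in `C` by convexity), a dense
complement of a countable set of parameters still meeting that interval.  For the pole-exclusion step of [MW] IV.3.12 (a) (★ `_on` edition p859569): the pole set `P` of ★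
`exists_global_pole_set` is co-discrete (`∀ z₀, ∀ᶠ s in 𝓝[≠] z₀, s ∉ P`), hence discrete, hence countable (`ℂ` is hereditarily Lindelöf), closed and contained in `{Re ≤ 1}`; so
`D₁ := D⁺ ∖ P` is open, preconnected, contained in `D⁺` and contains the sub-tube boxes `{3 < Re < 4, Im > 0}`, `{1 < Re < 2, Im > 0}` — exactly the binders of the `_on` edition.
* §1 `isPathConnected_convex_diff_of_countable`, `isPreconnected_convex_diff_of_countable` (real normed space, `1 < rank`).
* §2 `countable_of_codiscrete`, `isPreconnected_upperQuadrant_diff_of_countable`, **`upperQuadrant_diff_poleSet`** (the five binders of ★ `poleControl_continued_cm_two_of_pairing_on` at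
  `D₁ := D⁺ ∖ P`).
HONEST LABEL.  Count-neutral helper; proves no printed statement; HC_CM is proved only modulo the 7 printed citations (2 remaining named inputs: hLiu418 = `stmt-HodgeConjecture-24832`, h413 =
`stmt-HodgeConjecture-24833`) until rung 0 closes.

## References
* [MoeglinWaldspurger1995] C. Mœglin, J.-L. Waldspurger, *Spectral decomposition and Eisenstein series* (1995), IV.3.12 (a).
-/

set_option autoImplicit false
set_option linter.dupNamespace false  -- the mandated namespace repeats the summit's segment (`HodgeConjecture.HodgeConjecture`)

noncomputable section

open Set Metric Filter Topology
open scoped Convex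

namespace Summit.HodgeConjecture.HodgeConjecture.Cruxes.H413.K2E1ConvexDiffCountableConnected

/-! ## §1 Open convex minus countable is path-connected -/

section General

variable {E : Type*} [NormedAddCommGroup E] [NormedSpace ℝ E]

/-- **AN OPEN CONVEX SET MINUS A COUNTABLE SET IS PATH-CONNECTED** (real normed space of dimension `> 1`, the difference non-empty): Mathlib's two-segment argument
(`Set.Countable.isPathConnected_compl_of_one_lt_rank`) with the apex `c + t•y` kept in a small ball around the midpoint `c`, hence in `C`, the segments lying in `C` by convexity. [folklore] -/
theorem isPathConnected_convex_diff_of_countable (h : 1 < Module.rank ℝ E) {C : Set E} (hCc : Convex ℝ C) (hCo : IsOpen C) {s : Set E} (hs : s.Countable)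
    (hne : (C \ s).Nonempty) : IsPathConnected (C \ s) := by
  obtain ⟨a, ha⟩ := hne
  refine ⟨a, ha, ?_⟩
  intro b hb
  rcases eq_or_ne a b with rfl | hab
  · exact JoinedIn.refl ha
  let c := (2 : ℝ)⁻¹ • (a + b)
  let x := (2 : ℝ)⁻¹ • (b - a)
  have Ia : c - x = a := by
    simp only [c, x]
    module
  have Ib : c + x = b := by
    simp only [c, x]
    module
  have hcC : c ∈ C := by
    have h1 := hCc ha.1 hb.1 (by norm_num : (0 : ℝ) ≤ 2⁻¹) (by norm_num : (0 : ℝ) ≤ 2⁻¹) (by norm_num)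
    simp only [c, smul_add]
    exact h1
  have x_ne_zero : x ≠ 0 := by simpa [x] using sub_ne_zero.2 hab.symm
  obtain ⟨y, hy⟩ : ∃ y, LinearIndependent ℝ ![x, y] := exists_linearIndependent_pair_of_one_lt_rank h x_ne_zero
  -- a small parameter interval keeping the apex inside `C`
  obtain ⟨r, hr, hball⟩ := Metric.isOpen_iff.1 hCo c hcC
  set δ : ℝ := r / (‖y‖ + 1) with hδ
  have hy1 : 0 < ‖y‖ + 1 := by positivity
  have hδpos : 0 < δ := div_pos hr hy1
  have hapex : ∀ t ∈ Ioo (-δ) δ, c + t • y ∈ C := by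
    intro t ht
    refine hball ?_
    rw [Metric.mem_ball, dist_eq_norm, add_sub_cancel_left, norm_smul, Real.norm_eq_abs]
    have ht' : |t| < δ := abs_lt.2 ht
    calc |t| * ‖y‖ ≤ |t| * (‖y‖ + 1) := mul_le_mul_of_nonneg_left (by linarith) (abs_nonneg t)
      _ < δ * (‖y‖ + 1) := mul_lt_mul_of_pos_right ht' hy1
      _ = r := by rw [hδ, div_mul_cancel₀ _ hy1.ne']
  -- the countably many bad parameters
  have A : Set.Countable {t : ℝ | ([c + x -[ℝ] c + t • y] ∩ s).Nonempty} := by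
    apply countable_setOf_nonempty_of_disjoint _ (fun t ↦ inter_subset_right) hs
    intro t t' htt'
    apply disjoint_iff_inter_eq_empty.2
    have N : {c + x} ∩ s = ∅ := by
      simpa only [singleton_inter_eq_empty, Ib] using hb.2
    rw [inter_assoc, inter_comm s, inter_assoc, inter_self, ← inter_assoc, ← subset_empty_iff, ← N]
    apply inter_subset_inter_left
    apply Eq.subset
    apply segment_inter_eq_endpoint_of_linearIndependent_of_ne hy htt'.symm
  have B : Set.Countable {t : ℝ | ([c - x -[ℝ] c + t • y] ∩ s).Nonempty} := by
    apply countable_setOf_nonempty_of_disjoint _ (fun t ↦ inter_subset_right) hs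
    intro t t' htt'
    apply disjoint_iff_inter_eq_empty.2
    have N : {c - x} ∩ s = ∅ := by
      simpa only [singleton_inter_eq_empty, Ia] using ha.2
    rw [inter_assoc, inter_comm s, inter_assoc, inter_self, ← inter_assoc, ← subset_empty_iff, ← N]
    apply inter_subset_inter_left
    rw [sub_eq_add_neg _ x]
    apply Eq.subset
    apply segment_inter_eq_endpoint_of_linearIndependent_of_ne _ htt'.symm
    convert! hy.units_smul ![-1, 1]
    simp [← List.ofFn_inj]
  -- a good parameter in the small interval
  obtain ⟨t, ht, htI⟩ := ((A.union B).dense_compl ℝ).exists_mem_open isOpen_Ioo (nonempty_Ioo.2 (by linarith : -δ < δ))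
  let z := c + t • y
  have hzC : z ∈ C := hapex t htI
  simp only [compl_union, mem_inter_iff, mem_compl_iff, mem_setOf_eq, not_nonempty_iff_eq_empty] at ht
  have JA : JoinedIn (C \ s) a z := by
    apply JoinedIn.of_segment_subset
    rw [← Ia]
    refine fun p hp => ⟨hCc.segment_subset (Ia.symm ▸ ha.1) hzC hp, fun hps => ?_⟩
    have h0 : p ∈ [c - x -[ℝ] c + t • y] ∩ s := ⟨hp, hps⟩
    rw [ht.2] at h0
    exact h0
  have JB : JoinedIn (C \ s) b z := by
    apply JoinedIn.of_segment_subset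
    rw [← Ib]
    refine fun p hp => ⟨hCc.segment_subset (Ib.symm ▸ hb.1) hzC hp, fun hps => ?_⟩
    have h0 : p ∈ [c + x -[ℝ] c + t • y] ∩ s := ⟨hp, hps⟩
    rw [ht.1] at h0
    exact h0
  exact JA.trans JB.symm

/-- **AN OPEN CONVEX SET MINUS A COUNTABLE SET IS PRECONNECTED** (real normed space of dimension `> 1`). [folklore] -/
theorem isPreconnected_convex_diff_of_countable (h : 1 < Module.rank ℝ E) {C : Set E} (hCc : Convex ℝ C) (hCo : IsOpen C) {s : Set E} (hs : s.Countable) :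
    IsPreconnected (C \ s) := by
  rcases (C \ s).eq_empty_or_nonempty with h0 | hne
  · rw [h0]; exact isPreconnected_empty
  · exact (isPathConnected_convex_diff_of_countable h hCc hCo hs hne).isConnected.isPreconnected

end General

/-! ## §2 The domain `D⁺ ∖ P` of the `_on` edition -/

/-- **A CO-DISCRETE SUBSET OF `ℂ` IS COUNTABLE**: `∀ z₀, ∀ᶠ s in 𝓝[≠] z₀, s ∉ P` makes `P` discrete (Mathlib `isDiscrete_iff_nhdsNE`), and `ℂ` is hereditarily Lindelöf. [folklore] -/
theorem countable_of_codiscrete {P : Set ℂ} (hP : ∀ z₀ : ℂ, ∀ᶠ s in 𝓝[≠] z₀, s ∉ P) : P.Countable := by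
  have hdisc : IsDiscrete P := by
    rw [isDiscrete_iff_nhdsNE]
    intro x _
    rw [Filter.inf_principal_eq_bot]
    exact hP x
  exact (HereditarilyLindelofSpace.isLindelof P).countable_of_isDiscrete hdisc

/-- **`D⁺ ∖ P` IS PRECONNECTED** for every countable `P` (`D⁺ = {Re z > ½, Im z > 0}` is open and convex). [folklore] -/
theorem isPreconnected_upperQuadrant_diff_of_countable {P : Set ℂ} (hP : P.Countable) : IsPreconnected ({z : ℂ | 1 / 2 < z.re ∧ 0 < z.im} \ P) := by
  have hconv : Convex ℝ {z : ℂ | 1 / 2 < z.re ∧ 0 < z.im} := (convex_halfSpace_re_gt (1 / 2)).inter (convex_halfSpace_im_gt 0)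
  have hopen : IsOpen {z : ℂ | 1 / 2 < z.re ∧ 0 < z.im} := (isOpen_lt continuous_const Complex.continuous_re).inter (isOpen_lt continuous_const Complex.continuous_im)
  exact isPreconnected_convex_diff_of_countable Literature.Topology.Euclidean.one_lt_rank_real_complex hconv hopen hP

/-- **THE FIVE BINDERS OF THE `_on` EDITION AT `D₁ := D⁺ ∖ P`** for a closed co-discrete `P ⊆ {Re ≤ 1}` (the pole set of ★ `exists_global_pole_set`): `D₁` is open, preconnected, contained in `D⁺`,
and contains the sub-tube boxes `{3 < Re < 4, Im > 0}`, `{1 < Re < 2, Im > 0}`. [cite: MoeglinWaldspurger1995, IV.3.12 (a)] -/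
theorem upperQuadrant_diff_poleSet {P : Set ℂ} (hPc : IsClosed P) (hPd : ∀ z₀ : ℂ, ∀ᶠ s in 𝓝[≠] z₀, s ∉ P) (hPre : ∀ z ∈ P, z.re ≤ 1) :
    IsOpen ({z : ℂ | 1 / 2 < z.re ∧ 0 < z.im} \ P) ∧ IsPreconnected ({z : ℂ | 1 / 2 < z.re ∧ 0 < z.im} \ P) ∧
      ({z : ℂ | 1 / 2 < z.re ∧ 0 < z.im} \ P ⊆ {z : ℂ | 1 / 2 < z.re ∧ 0 < z.im}) ∧
      ({z : ℂ | (3 < z.re ∧ z.re < 4) ∧ 0 < z.im} ⊆ {z : ℂ | 1 / 2 < z.re ∧ 0 < z.im} \ P) ∧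
      ({z : ℂ | (1 < z.re ∧ z.re < 2) ∧ 0 < z.im} ⊆ {z : ℂ | 1 / 2 < z.re ∧ 0 < z.im} \ P) := by
  have hopen : IsOpen {z : ℂ | 1 / 2 < z.re ∧ 0 < z.im} := (isOpen_lt continuous_const Complex.continuous_re).inter (isOpen_lt continuous_const Complex.continuous_im)
  refine ⟨hopen.sdiff hPc, isPreconnected_upperQuadrant_diff_of_countable (countable_of_codiscrete hPd), Set.sdiff_subset, fun z hz => ⟨⟨by linarith [hz.1.1], hz.2⟩, fun hzP => ?_⟩,
    fun z hz => ⟨⟨by linarith [hz.1.1], hz.2⟩, fun hzP => ?_⟩⟩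
  · linarith [hPre z hzP, hz.1.1]
  · linarith [hPre z hzP, hz.1.1]

end Summit.HodgeConjecture.HodgeConjecture.Cruxes.H413.K2E1ConvexDiffCountableConnected

end
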